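import Mathlib
import Literature.Barriers.ValiantsHypothesis.AlgebraicNaturalProofs
import HarnessLib

/-!
# Crux `BarrierLever.SuccinctHittingSetsForVP` (stmt-ValiantsHypothesis-14610), line `registered` —
THE FINITE SET OF MULTILINEAR COEFFICIENT COORDINATES (registered stub `stub_multilinearCoords`)

**What is proved (it does NOT close the item).** The registered stub `stub_multilinearCoords` of the
skeleton `Cruxes/SuccinctHittingSetsForVP/Lines/birth.lean`: for every `n : ℕ` there is a
`Finset` `T` of coefficient coordinates `degLEMonomials n` (exponent vectors of degree `≤ n` in `n`
variables) consisting exactly of the MULTILINEAR exponent vectors, `μ ∈ T ↔ ∀ i, μ i ≤ 1`.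

**Why.** Forbes–Shpilka–Volk 2018, Thm. 9, gives succinct hitting sets against sparse
distinguishers in the MULTILINEAR regime; the tree's crux (Question 6) lives in the regime `d = n`
with `N = binom(2n, n)` coordinates. The neighbour glue stub restricts a distinguisher to the `2^n`
multilinear coordinates and transports it to the polynomial ring on them, for which it needs these
coordinates as a `Finset` of `degLEMonomials n` with its membership characterisation.

Mechanism: `degLEMonomials n = {m : Fin n →₀ ℕ | m.degree ≤ n}` is finite by Mathlib's
`Finsupp.finite_of_degree_le` (finitely many exponent vectors of bounded degree over a finite index
type), so the subtype carries a (classical) `Fintype` structure and `T` is the filter of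
`Finset.univ` by the multilinearity predicate. Axioms: `propext`, `Classical.choice`, `Quot.sound`.
References: [ForbesShpilkaVolk2018] Thm. 9 and Question 6; folklore.
-/

-- layout Summits/ValiantsHypothesis/ValiantsHypothesis forces the duplicated namespace component
set_option linter.dupNamespace false

namespace Summit.ValiantsHypothesis.ValiantsHypothesis.Theorems.BarrierLever.SuccinctHittingSetsForVP

open Literature.Barriers.ValiantsHypothesis Literature.Computability.AlgebraicComplexity MvPolynomial

namespace MultilinearCoords

/-- The coefficient coordinates `degLEMonomials n` (exponent vectors of degree `≤ n` in `n`
variables) form a finite set. [folklore] -/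
theorem finite_degLEMonomials (n : ℕ) : (degLEMonomials n).Finite :=
  Finsupp.finite_of_degree_le n

/-- A multilinear exponent vector (all entries `≤ 1`) in `n` variables has degree `≤ n`, i.e. it is
one of the coefficient coordinates `degLEMonomials n`. [folklore] -/
theorem mem_degLEMonomials_of_forall_le_one {n : ℕ} {m : Fin n →₀ ℕ} (hm : ∀ i, m i ≤ 1) :
    m ∈ degLEMonomials n := by
  show m.degree ≤ n
  calc m.degree = ∑ i, m i := Finsupp.degree_eq_sum m
    _ ≤ ∑ _i : Fin n, 1 := Finset.sum_le_sum fun i _ => hm i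
    _ = n := by rw [Finset.sum_const, Finset.card_univ, Fintype.card_fin, smul_eq_mul, mul_one]

end MultilinearCoords

/-- **Registered stub `stub_multilinearCoords`** (crux stmt-ValiantsHypothesis-14610, line
`registered`; the finite set of multilinear coefficient coordinates): for every `n` the multilinear
exponent vectors (all entries `≤ 1`; there are `2^n` of them, each of degree `≤ n`) form a `Finset`
of the coefficient coordinates `degLEMonomials n`, characterised by membership.
[cite: ForbesShpilkaVolk2018, Thm. 9] [folklore] -/
theorem stub_multilinearCoords :
    ∀ n : ℕ, ∃ T : Finset (degLEMonomials n),
      ∀ μ : degLEMonomials n, μ ∈ T ↔ ∀ i, (μ : Fin n →₀ ℕ) i ≤ 1 := by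
  intro n
  classical
  haveI : Fintype (degLEMonomials n) := (MultilinearCoords.finite_degLEMonomials n).fintype
  exact ⟨Finset.univ.filter fun μ : degLEMonomials n => ∀ i, (μ : Fin n →₀ ℕ) i ≤ 1,
    fun μ => by simp only [Finset.mem_filter, Finset.mem_univ, true_and]⟩

end Summit.ValiantsHypothesis.ValiantsHypothesis.Theorems.BarrierLever.SuccinctHittingSetsForVP
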